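import Mathlib
import Literature.NumberTheory.GaloisRepresentations.LocalClassFieldTheory
import Literature.NumberTheory.GaloisRepresentations.HeckeCharacterGaloisAvatarProofs
import HarnessLib

/-!
# ArtinCharacterLocalGlobal

Topic `Literature/NumberTheory/GaloisRepresentations`. Named literature fact(s) relocated by the gate from `Summits/Langlands/Langlands/Theorems/IrreducibilityBySelfDualityReciprocityUpToIrreducibilityArtinLocalGlobal.lean`
(accept-time relocation of `[cite]`d propositions written inline in a Summits proposal; human ruling 2026-08-15).
Sources: NeukirchANT1999, TateCorvallis1979.

* `Literature.NumberTheory.GaloisRepresentations.artinCharacter_localGlobalCompatible`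
-/

namespace Literature.NumberTheory.GaloisRepresentations

open scoped MatrixGroups Matrix NumberField Classical Polynomial
open Filter IsDedekindDomain Field Polynomial
open Literature.NumberTheory.Automorphic Literature.NumberTheory.GaloisRepresentations

/-- **Compatibility of local and global class field theory, character form** (Neukirch, *Algebraic
Number Theory*, Ch. VI, Prop. (5.6): for a finite abelian `L|K` and a place `v`, the local norm residue
symbol `( , L_v|K_v) : K_vˣ → G(L_v|K_v)` followed by `G(L_v|K_v) ↪ G(L|K)` equals the global norm
residue symbol on the idèles `⟨a_v⟩ = (…, 1, a_v, 1, …)`).  Rendered for characters, in the tree's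
vocabulary: let `θ` be a Hecke character of finite order of the number field `K` and `ψ : Γ_K → GL₁(ℂ)`
the rank-one Artin representation attached to it by Artin reciprocity — unramified exactly where `θ` is,
with `char ψ(Frob_v^{arith}) = X - θ(ϖ_v)` there (`HeckeCharacter.exists_framedArtinRep_of_isFiniteOrder`,
unique by `HeckeCharacter.framedArtinRep_unique`); then for EVERY finite place `v` (ramified ones
included) and every local Artin map `a : W_{K_v} →* K_vˣ` with the characterising clauses
`IsLocalArtinMap` (geometric Frobenius ↦ uniformiser — Deligne's normalisation `a(w) = (θ_v⁻¹[w])⁻¹`,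
Tate (1.4.1) — and the finite-level reciprocity law, which determine `a` uniquely, Milne I Thm. 1.1),
`tr ψ(w) = θ_v(a(w))⁻¹` for all `w ∈ W_{K_v}` (restriction to `Γ_K` along the tree's
`absGaloisRestrict K K_v ∘ WeilGroup.toAbsGalois`), where `θ_v = θ ∘ localUnits v` is the local component.
[cite: NeukirchANT1999, Ch. VI Prop. (5.6)] [cite: TateCorvallis1979, (1.4.1)]
[file NumberTheory/GaloisRepresentations/ArtinCharacterLocalGlobal] -/
def artinCharacter_localGlobalCompatible : Prop :=
  ∀ (K : Type) [Field K] [NumberField K] (θ : HeckeCharacter K), θ.IsFiniteOrder →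
    ∀ ψ : FramedArtinRep K 1,
      (∀ v : HeightOneSpectrum (𝓞 K), ψ.IsUnramifiedAt v ↔ θ.IsUnramifiedAt v) →
      (∀ v : HeightOneSpectrum (𝓞 K), θ.IsUnramifiedAt v →
        ψ.HasFrobCharpolyAt v (X - C (θ.valueAtUniformizer v))) →
      ∀ (v : HeightOneSpectrum (𝓞 K)) (a : WeilGroup (v.adicCompletion K) →* (v.adicCompletion K)ˣ),
        IsLocalArtinMap (v.adicCompletion K) a →
        ∀ w : WeilGroup (v.adicCompletion K),
          ((ψ (absGaloisRestrict K (v.adicCompletion K)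
              (WeilGroup.toAbsGalois (v.adicCompletion K) w)) : GL (Fin 1) ℂ) :
              Matrix (Fin 1) (Fin 1) ℂ).trace =
            (((θ.localComponent v (a w))⁻¹ : ℂˣ) : ℂ)

-- summit-side namespaces are opened only AFTER the named fact (the gate relocates the fact, with the
-- preamble above it, into `Literature/`, where these namespaces do not exist)

end Literature.NumberTheory.GaloisRepresentations
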